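import Mathlib
import Literature.MathematicalPhysics.QuantumFieldTheory.Balaban1983to89.B8SectDSource
import Literature.MathematicalPhysics.QuantumFieldTheory.Balaban1983to89.B8SectE

/-!
# `Balaban1983to89.B8Prop5Repaired` — Proposition 5 of B8 under the REPAIRED remainder bound (1.99) (census
G-B8-11, G-B8-12) and its uniqueness clause (1.109) assembled in the ORIGINAL variable, kernel-checked as abstract
Banach-space lemmas

statement-level skeleton of published theorems with citation tags; proofs where landed; nothing here is a claim
about the Yang–Mills mass gap

CITATION HEADER (lean-in-tree rule 2026-08-18). Reproduction, at the level of abstract Banach-space lemmas with the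
PRINTED bounds as named hypotheses, of the existence clause (1.107)–(1.108) and the uniqueness clause (1.109) of
Proposition 5 of T. Bałaban, *Spaces of regular gauge field configurations on a lattice and gauge fixing
conditions*, Comm. Math. Phys. **99**, 75–102 (1985) [Balaban1985RegularSpaces] (cell paper B8; PDF held
`paper:balaban1985-cmp99-regular-spaces-gauge-fixing`, journal page = PDF page + 74; renders of pp. 93, 94, 95, 96,
97 read 2026-08-18).  The paper is a manuscript UNDER ADJUDICATION by the audit cell `pub-balaban`; nothing of it
is asserted here.  Every theorem below is an elementary, sorry-free statement about maps between complete normed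
spaces; the lattice content of B8 enters only through the NAMES of the hypotheses, which a reader must still
discharge from the printed text.  Sibling modules used: `B8SectDSource` (§1 `fixedPoint_closedBall`, §2
`lipschitz_of_norm_le`: Banach's theorem on a closed ball and the Cauchy estimate behind (1.104)–(1.106); §5
`propFive_source`: the Sect. D contraction with a source term, Theorem 8) and `B8SectE` (`onto_of_lipschitz_half`:
the "onto" sentence of p. 97).  Nothing else is imported.

WHAT IS PRINTED.  p. 93 [PDF 19], before (1.99): "This and (1.96) implies that the operator (I + RVR)⁻¹ applied to
the last term in (1.93) gives a term bounded by O(1)B₁(α₀+α₁)α₄(L^jη)⁻² on Ω_j. We get the same bound for the term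
with D*A (but with RD*A subtracted), and with ΔH′D′(u₁, λ). Thus we have the bound |R𝔉₄(λ, Dλ, A, D*A)| ≦
C′₄B₁(α₀+α₁)α₄(L^jη)⁻² on Ω_j (1.99) for j < k."; (1.100) "λ = G′RD*A + G′R𝔉₄(λ, Dλ, A, D*A)."; "We will prove
that for α₀ + α₁ sufficiently small and for α₄ chosen properly there exists exactly one fixed point of 𝔉.";
(1.101)–(1.103) and p. 94 [PDF 20] (1.104)–(1.106) as quoted in the header of `B8SectDSource`; p. 94: "To get a
best uniqueness result we have to take a largest possible α₄. It is independent of α₀ + α₁. To get best bounds on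
the solution we have to take a smallest possible α₄, hence α₄ = 8B′₀B₁(α₀+α₁), and then we have to assume that
α₀ + α₁ is so small that all the conditions on α₀ + α₁, α₄ are satisfied. The solution λ of Eq. (1.100)
determines the configuration u′ = exp[i(λ − H′D′(u₁, λ))] we are looking for."; Proposition 5: "There exist
positive constants c₂, c₃, depending on d and L only, such that … if α₀ + α₁ ≦ c₂, then there exists a
configuration u′ = e^{iλ} satisfying the equations … (1.107) and the bounds |λ|, |Dλ|₍₋₁₎ < 8B′₀B₁(α₀+α₁). (1.108)
Such a configuration u′ is unique in the domain |λ|, |Dλ|₍₋₁₎ < c₃. (1.109)"; "The part of this proposition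
concerning the existence of u′ was proved completely. The uniqueness follows from the fact that the image of a set
{λ : |λ|, |Dλ|₍₋₁₎ < ½α₄} by the transformation λ → λ − H′D′(u₁, λ) contains the set {λ′ : |λ′|, |Dλ′|₍₋₁₎ < ¼α₄
for α₄ sufficiently small. This follows from results of the next section."  p. 96 [PDF 22] (1.119): "|λ| < ½α₄,
|Dλ| < ½α₄(L^jη)⁻¹ on Ω_j, |X| < (1/(2B′₀))α₄."; (1.121): "|C′(λ − H′X)| < C′₂(α₃+α₄)α₄".  p. 97 [PDF 23]: "hence
the mapping (1.118) is contractive if e.g. α₃ + α₄ ≦ 1/(4B′₀C′₂)."; "|D′(λ)| = |C′(λ − H′D′(λ))| < C′₂(α₃+α₄)α₄.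
They imply in particular that the mapping (1.113) transforms the set {λ : |λ| < ½α₄, |Dλ| < ½α₄(L^jη)⁻¹ on Ω_j}
onto a set containing {λ′ : |λ′| < ¼α₄, |Dλ′| < ¼α₄(L^jη)⁻¹ on Ω_j} for α₃, α₄ sufficiently small."

THE CELL'S OBJECTIONS THIS FILE ANSWERS (GAPS.md; repairs previously stated in prose only).  G-B8-12: the α₄²-part of
the Sect. E bound (1.121) on `D′` carries no factor `B₁(α₀+α₁)`, so the ΔH′D′(u₁, λ) contribution to (1.99) is
`O(α₄)α₄`, not `O(B₁(α₀+α₁))α₄`; repaired (1.99): `|R𝔉₄| ≤ C′₄(B₁(α₀+α₁) + α₄)α₄(L^jη)⁻²`.  G-B8-11: the A-free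
third-order terms omitted in (1.84)/(1.85), (1.88)/(1.89) add `O(α₄³)(L^jη)⁻²`.  Both repairs have the shape
"(1.99) with `B₁(α₀+α₁)` replaced by `B₁(α₀+α₁) + ρ`, `ρ ≥ 0` free of `B₁(α₀+α₁)`" (`ρ = α₄ + α₄²` up to the
O(1) constants).  The cell's prose claim was: constants only, Proposition 5 intact, the factor 8 of (1.108)
survives.  §1 below certifies exactly that, with the explicit condition replacing "α₀ + α₁ ≦ c₂".

WHAT IS NOT PRINTED (located here, constants only).  (d) (1.108) is a bound on the exponent of
`u′ = exp[i(λ − H′D′(u₁, λ))]`, i.e. on `μ := λ − H′D′(u₁, λ)`, not on the fixed point `λ` of (1.100) (for which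
p. 94 gives `|λ| ≤ 2B′₀B₁(α₀+α₁)`); it therefore also uses the Sect. E bound `|H′D′(u₁, λ)| ≤ B′₀C′₂(α₃+α₄)α₄` AT THE
SMALL PARAMETER `α₄ = 8B′₀B₁(α₀+α₁)`, where (p. 97) `α₃ + α₄ ≦ 1/(4B′₀C′₂)` gives `|H′D′| ≤ ¼α₄ = 2B′₀B₁(α₀+α₁)` and
hence `|μ| ≤ 4B′₀B₁(α₀+α₁) < 8B′₀B₁(α₀+α₁)` — (1.108) holds with room (theorem `propFive_assembled`, hypothesis
`hFmin`).  (e) The uniqueness sentence pairs the "onto" statement (preimage in the β = ½ domain) with the fixed-point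
uniqueness delivered by the contraction on the β = ¼ domain; this is consistent AS PRINTED because (1.101) with
(1.103), β = ¼, sends the whole β = ½ domain into the closed β = ¼ ball, so every fixed point of the β = ½ domain
lies in the β = ¼ ball (`fixedPoint_of_sup_bound`, last clause) — recorded so that no reader mistakes it for a
gap; `c₃ = ¼α₄` at the LARGEST admissible α₄, exactly as printed.

WHAT THIS FILE PROVES (`E`, `F` complex Banach spaces as in `B8SectDSource`; `s := α₀ + α₁`; `𝔉 λ := G′(g₀ + Φ λ)`
with `g₀ = RD*A`, `Φ = R𝔉₄(·, A, D*A)`; `T λ := λ − Fλ` the Sect. E map (1.113), `F = H′D′(u₁, ·)`; an abstract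
predicate `Sol μ` standing for "u′ = e^{iμ} satisfies (1.107)"):
* §1 `fixedPoint_of_sup_bound` — the contraction in "M-form": `‖G′‖ ≤ B′₀`, `‖g₀‖ ≤ m₀`, `Φ` analytic with
  `‖Φ‖ ≤ M` on the open ½α-ball, `8B′₀M ≤ α`, `8B′₀m₀ ≤ α` ⟹ `𝔉` maps the open ½α-ball into the closed ball of
  radius `B′₀(m₀ + M) ≤ ¼α`, is `4B′₀M/α ≤ ½`-Lipschitz on the closed ¼α-ball, has exactly one fixed point there,
  and every fixed point of the open ½α-ball has norm `≤ B′₀(m₀ + M)`.  `propFive_repaired`,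
  `propFive_repaired_choice` — the instance `M = C′₄(B₁s + ρ)α₄`: under `8B′₀C′₄(B₁s + ρ) ≤ 1` and `8B′₀B₁s ≤ α₄`
  a unique fixed point in `‖λ‖ ≤ ¼α₄`; at the PRINTED choice `α₄ = 8B′₀B₁s` it has `‖λ‖ ≤ 2B′₀B₁s < 8B′₀B₁s` —
  the printed constant 8 of (1.108) intact; `repaired_condition_eq` — with `ρ = α₄ + α₄²` the condition reads
  `C′₄α₄(1 + 8B′₀(1 + α₄)) ≤ 1` (printed: `C′₄α₄ ≤ 1`): a smaller `c₂`, nothing else.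
* §2 `unique_of_onto`, `sol_eq_image_of_onto` — the printed uniqueness argument as pure logic: image bound on the
  open ½α-ball + uniqueness of fixed points in the closed ¼α-ball + "onto" + the dictionary
  `Sol (T λ) → 𝔉 λ = λ` (`‖λ‖ < ½α`) ⟹ at most one `μ` with `‖μ‖ < ¼α` and `Sol μ`; `onto_half_ball` — the "onto"
  input from `B8SectE.onto_of_lipschitz_half`.
* §3 `propFive_assembled`, `propFive_printed_shape` — Proposition 5 with BOTH clauses: existence at the smallest
  parameter `8B′₀B₁s` (repaired (1.99)), (1.108) for `μ = T λ` in the form `‖μ‖ ≤ 2B′₀B₁s + φ` (`φ` = the Sect. E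
  bound on `F` at that parameter; `φ ≤ 2B′₀B₁s` gives `< 8B′₀B₁s`), uniqueness of `Sol` in `‖μ‖ < ¼α` at the largest
  parameter `α` (`c₃ = ¼α`, independent of `s`), and `8B′₀B₁s ≤ ¼α` (i.e. `32B′₀B₁s ≤ α`, one more clause of
  "α₀ + α₁ ≦ c₂") placing the constructed `μ` inside the uniqueness domain: `∃! μ, ‖μ‖ < ¼α ∧ Sol μ`.
* §4 `source_uniqueness` — the same uniqueness logic for the source transformation of Theorem 8
  (`B8SectDSource.propFive_source`): "exactly one" in Theorem 8, Sect. D part, modulo the same named inputs.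
NOT covered (and not claimed): the discharge of (1.99) (printed or repaired), of the Sect. E inputs (1.92), (1.121),
(1.125), of the dictionary hypotheses (the Sect. C–D algebra (1.76)–(1.95) turning (1.107) for
`u′ = exp[i(λ − H′D′(u₁, λ))]` into (1.100) for `λ`, and back), and the `|Dλ|`-component caveat of `B8SectE`
(GAPS C-A3-1: the onto step is certified for the sup-norm component).

Unit `b2b-balaban-b08-g5` (paper sub-cell B08, generation 5).  Census rows: GAPS.md C-B8-23 (kernel certificate of
the G-B8-11/G-B8-12 repair and of the (1.109) assembly), G-B8-18 (remarks (d), (e) above); DIVERGENCE.md D-b08-g5.1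
(abstract typing; `Sol` and the dictionary as named hypotheses).
Value: kernel-checked bookkeeping of two census objections and of a printed two-line uniqueness argument, NOT
summit progress.

v1.1 (lit-balaban r05, 2026-08-20): locator tags `[cite: Balaban1985RegularSpaces, …]` added to the declaration
docstrings (SKELETON rows B8.Eq1.99, B8.Prop5, B8.Claim@97; MISSING-SOURCES §C.2); no declaration, statement or
proof changed.  The tags locate the PRINTED displays each abstract lemma reproduces or repairs; the repaired
readings remain the cell's, as said in each docstring.
v1.2 (lit-balaban r05 gen 3, 2026-08-21; DOCSTRING-ONLY): the skeleton's framing line moved to page 1 of this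
module docstring (REFEREE-3 §16/§21 framing lint reads the first 6000 characters); nothing else changed.
-/

noncomputable section

namespace Literature.MathematicalPhysics.QuantumFieldTheory.Balaban1983to89.B8Prop5Repaired

open Set Metric

/-! ## §1. The Sect. D contraction under the repaired (1.99) -/

section Existence

variable {E F : Type*} [NormedAddCommGroup E] [NormedSpace ℂ E] [CompleteSpace E]
  [NormedAddCommGroup F] [NormedSpace ℂ F]

/-- **The contraction of pp. 93–94 in M-form.**  Data: `G′ : F → E` with `‖G′‖ ≤ B′₀` (p. 93, "[4], Theorem 3.1"),
`g₀` (= `RD*A`) with `‖g₀‖ ≤ m₀`, `Φ` (= `R𝔉₄(·, A, D*A)`) complex-differentiable on the open ball of radius `½α`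
(the domain (1.102) with `β = ½`) and bounded there by `M` (the right side of (1.99), whatever it is).  If
`8B′₀M ≤ α` and `8B′₀m₀ ≤ α`, then `𝔉 λ := G′(g₀ + Φ λ)` (1.100) satisfies: the image of the open ½α-ball lies in
the closed ball of radius `B′₀(m₀ + M) ≤ ¼α` ((1.101) + (1.103)); on the closed ¼α-ball it is Lipschitz with
constant `4B′₀M/α ≤ ½` ((1.104)–(1.106), Cauchy estimate with radii `½α`, `¼α`); it has exactly one fixed point in
the closed ¼α-ball; and EVERY fixed point of the open ½α-ball has norm `≤ B′₀(m₀ + M)` (so lies in the closed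
¼α-ball — the bookkeeping behind the printed uniqueness sentence of p. 94). [cite: Balaban1985RegularSpaces,
(1.100)–(1.103) p.93; (1.104)–(1.106) pp.93–94; remainder bound (1.99) p.93 (as the hypothesis `M`)] -/
theorem fixedPoint_of_sup_bound (G' : F →L[ℂ] E) (g₀ : F) (Φ : E → F) {B₀' m₀ M α : ℝ}
    (hα : 0 < α) (hG : ‖G'‖ ≤ B₀') (hg₀ : ‖g₀‖ ≤ m₀)
    (hΦd : DifferentiableOn ℂ Φ (ball (0 : E) (α / 2)))
    (hΦM : ∀ lam ∈ ball (0 : E) (α / 2), ‖Φ lam‖ ≤ M)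
    (hM : 8 * B₀' * M ≤ α) (hm₀ : 8 * B₀' * m₀ ≤ α) :
    (∀ lam ∈ ball (0 : E) (α / 2), ‖G' (g₀ + Φ lam)‖ ≤ B₀' * (m₀ + M)) ∧
    B₀' * (m₀ + M) ≤ α / 4 ∧
    (∀ lam₁ lam₂ : E, ‖lam₁‖ ≤ α / 4 → ‖lam₂‖ ≤ α / 4 →
        ‖G' (g₀ + Φ lam₁) - G' (g₀ + Φ lam₂)‖ ≤ (4 * B₀' * M / α) * ‖lam₁ - lam₂‖) ∧
    4 * B₀' * M / α ≤ 1 / 2 ∧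
    (∃! lam : E, ‖lam‖ ≤ α / 4 ∧ G' (g₀ + Φ lam) = lam) ∧
    (∀ lam : E, ‖lam‖ < α / 2 → G' (g₀ + Φ lam) = lam → ‖lam‖ ≤ B₀' * (m₀ + M)) := by
  have hB : 0 ≤ B₀' := (norm_nonneg _).trans hG
  have hM0 : 0 ≤ M := (norm_nonneg _).trans (hΦM 0 (mem_ball_self (by linarith)))
  -- (1.101): the image of the open ½α-ball
  have himg : ∀ lam ∈ ball (0 : E) (α / 2), ‖G' (g₀ + Φ lam)‖ ≤ B₀' * (m₀ + M) := by
    intro lam hlam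
    calc ‖G' (g₀ + Φ lam)‖ ≤ ‖G'‖ * ‖g₀ + Φ lam‖ := G'.le_opNorm _
      _ ≤ B₀' * (‖g₀‖ + ‖Φ lam‖) := by
          have := norm_add_le g₀ (Φ lam)
          gcongr
      _ ≤ B₀' * (m₀ + M) := by
          have := hΦM lam hlam
          gcongr
  -- (1.103): the image radius is at most ¼α
  have hBM : B₀' * M ≤ α / 8 := by nlinarith
  have hBm : B₀' * m₀ ≤ α / 8 := by nlinarith
  have hquarter : B₀' * (m₀ + M) ≤ α / 4 := by nlinarith
  have hsub : ∀ lam : E, ‖lam‖ ≤ α / 4 → lam ∈ ball (0 : E) (α / 2) := fun lam h =>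
    mem_ball_zero_iff.2 (by linarith)
  -- (1.104)–(1.106): the Lipschitz constant on the closed ¼α-ball through the Cauchy estimate
  have hlip : ∀ lam₁ lam₂ : E, ‖lam₁‖ ≤ α / 4 → ‖lam₂‖ ≤ α / 4 →
      ‖G' (g₀ + Φ lam₁) - G' (g₀ + Φ lam₂)‖ ≤ (4 * B₀' * M / α) * ‖lam₁ - lam₂‖ := by
    intro lam₁ lam₂ h₁ h₂
    have hΦlip := B8SectDSource.lipschitz_of_norm_le hΦd hΦM (by linarith : α / 4 < α / 2) h₁ h₂
    have hc : M / (α / 2 - α / 4) = 4 * M / α := by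
      field_simp
      ring
    rw [hc] at hΦlip
    calc ‖G' (g₀ + Φ lam₁) - G' (g₀ + Φ lam₂)‖ = ‖G' (Φ lam₁ - Φ lam₂)‖ := by
          rw [← map_sub]; congr 1; abel
      _ ≤ ‖G'‖ * ‖Φ lam₁ - Φ lam₂‖ := G'.le_opNorm _
      _ ≤ B₀' * (4 * M / α * ‖lam₁ - lam₂‖) := by gcongr
      _ = (4 * B₀' * M / α) * ‖lam₁ - lam₂‖ := by ring
  have hκ : 4 * B₀' * M / α ≤ 1 / 2 := by
    rw [div_le_iff₀ hα]
    nlinarith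
  have hκ0 : 0 ≤ 4 * B₀' * M / α := by positivity
  have hmaps : ∀ lam : E, ‖lam‖ ≤ α / 4 → ‖G' (g₀ + Φ lam)‖ ≤ α / 4 := fun lam h =>
    (himg lam (hsub lam h)).trans hquarter
  refine ⟨himg, hquarter, hlip, hκ, B8SectDSource.fixedPoint_closedBall (fun lam => G' (g₀ + Φ lam))
    (by linarith) hκ0 (by linarith) hmaps hlip, ?_⟩
  intro lam hlam hfix
  have h := himg lam (mem_ball_zero_iff.2 hlam)
  rwa [hfix] at h

/-- **Proposition 5, existence part, under the REPAIRED (1.99)** (census G-B8-11, G-B8-12).  The printed (1.99)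
`|R𝔉₄| ≤ C′₄B₁(α₀+α₁)α₄` is replaced by `‖Φ λ‖ ≤ C′₄(B₁s + ρ)α₄` on the domain (1.102) with `β = ½`, where
`ρ ≥ 0` is any allowance free of `B₁s` (G-B8-12: the `α₄²`-part of (1.121) through ΔH′D′(u₁, λ); G-B8-11: the
A-free third-order remainders; together `ρ = O(α₄ + α₄²)`).  Under `8B′₀C′₄(B₁s + ρ) ≤ 1` (replacing the printed
`C′₄α₄ ≤ 1`; it makes the contraction constant `4B′₀C′₄(B₁s + ρ) ≤ ½`) and `8B′₀B₁s ≤ α₄` (the printed second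
clause of (1.103) with `β = ¼`), `𝔉` has exactly one fixed point with `‖λ‖ ≤ ¼α₄`; every fixed point of the open
½α₄-ball has `‖λ‖ ≤ B′₀B₁s + B′₀C′₄(B₁s + ρ)α₄ ≤ ¼α₄`. [cite: Balaban1985RegularSpaces, Proposition 5
(1.107)–(1.108) p.94 (existence clause); (1.99) p.93 (printed form of the repaired hypothesis); (1.103) p.93] -/
theorem propFive_repaired (G' : F →L[ℂ] E) (g₀ : F) (Φ : E → F) {B₀' B₁ C₄' s ρ α₄ : ℝ}
    (hα₄ : 0 < α₄) (hG : ‖G'‖ ≤ B₀') (hg₀ : ‖g₀‖ ≤ B₁ * s)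
    (hΦd : DifferentiableOn ℂ Φ (ball (0 : E) (α₄ / 2)))
    (h99R : ∀ lam ∈ ball (0 : E) (α₄ / 2), ‖Φ lam‖ ≤ C₄' * (B₁ * s + ρ) * α₄)
    (h103R : 8 * B₀' * C₄' * (B₁ * s + ρ) ≤ 1) (h103b : 8 * B₀' * B₁ * s ≤ α₄) :
    (∃! lam : E, ‖lam‖ ≤ α₄ / 4 ∧ G' (g₀ + Φ lam) = lam) ∧
    (∀ lam : E, ‖lam‖ < α₄ / 2 → G' (g₀ + Φ lam) = lam →
        ‖lam‖ ≤ B₀' * B₁ * s + B₀' * C₄' * (B₁ * s + ρ) * α₄) ∧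
    B₀' * B₁ * s + B₀' * C₄' * (B₁ * s + ρ) * α₄ ≤ α₄ / 4 := by
  have hM : 8 * B₀' * (C₄' * (B₁ * s + ρ) * α₄) ≤ α₄ := by
    have e : 8 * B₀' * (C₄' * (B₁ * s + ρ) * α₄) = (8 * B₀' * C₄' * (B₁ * s + ρ)) * α₄ := by ring
    rw [e]
    exact mul_le_of_le_one_left hα₄.le h103R
  have hm₀ : 8 * B₀' * (B₁ * s) ≤ α₄ := by linarith
  obtain ⟨-, hq, -, -, hex, hbd⟩ := fixedPoint_of_sup_bound G' g₀ Φ hα₄ hG hg₀ hΦd h99R hM hm₀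
  have e : B₀' * (B₁ * s + C₄' * (B₁ * s + ρ) * α₄) = B₀' * B₁ * s + B₀' * C₄' * (B₁ * s + ρ) * α₄ := by
    ring
  refine ⟨hex, fun lam h hfix => ?_, ?_⟩
  · have h' := hbd lam h hfix
    rw [e] at h'
    exact h'
  · rw [← e]
    exact hq

/-- **Proposition 5 with Bałaban's choice `α₄ = 8B′₀B₁(α₀+α₁)` under the repaired (1.99)** (p. 94: "To get best
bounds on the solution we have to take a smallest possible α₄, hence α₄ = 8B′₀B₁(α₀+α₁)").  With this choice the
clause `8B′₀B₁s ≤ α₄` is an equality and the SINGLE remaining condition is `8B′₀C′₄(B₁s + ρ) ≤ 1`; the fixed point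
is unique in `‖λ‖ ≤ 2B′₀B₁s`, every fixed point of the open ball `‖λ‖ < 4B′₀B₁s` has `‖λ‖ ≤ 2B′₀B₁s`, and
`2B′₀B₁s < 8B′₀B₁s` — the printed constant 8 of (1.108) survives the repair (census G-B8-12: "the factor 8
survives"). [cite: Balaban1985RegularSpaces, (1.108) p.94; choice «α₄ = 8B′₀B₁(α₀+α₁)» p.94] -/
theorem propFive_repaired_choice (G' : F →L[ℂ] E) (g₀ : F) (Φ : E → F) {B₀' B₁ C₄' s ρ : ℝ}
    (hB₀ : 0 < B₀') (hB₁ : 0 < B₁) (hs : 0 < s) (hG : ‖G'‖ ≤ B₀') (hg₀ : ‖g₀‖ ≤ B₁ * s)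
    (hΦd : DifferentiableOn ℂ Φ (ball (0 : E) (8 * B₀' * B₁ * s / 2)))
    (h99R : ∀ lam ∈ ball (0 : E) (8 * B₀' * B₁ * s / 2),
      ‖Φ lam‖ ≤ C₄' * (B₁ * s + ρ) * (8 * B₀' * B₁ * s))
    (hsmall : 8 * B₀' * C₄' * (B₁ * s + ρ) ≤ 1) :
    (∃! lam : E, ‖lam‖ ≤ 2 * B₀' * B₁ * s ∧ G' (g₀ + Φ lam) = lam) ∧
    (∀ lam : E, ‖lam‖ < 4 * B₀' * B₁ * s → G' (g₀ + Φ lam) = lam → ‖lam‖ ≤ 2 * B₀' * B₁ * s) ∧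
    2 * B₀' * B₁ * s < 8 * B₀' * B₁ * s := by
  have hα₄ : 0 < 8 * B₀' * B₁ * s := by positivity
  obtain ⟨hex, hbd, hq⟩ :=
    propFive_repaired G' g₀ Φ hα₄ hG hg₀ hΦd h99R hsmall le_rfl
  have e1 : 8 * B₀' * B₁ * s / 4 = 2 * B₀' * B₁ * s := by ring
  have e2 : 8 * B₀' * B₁ * s / 2 = 4 * B₀' * B₁ * s := by ring
  rw [e1] at hex hq
  have hp : 0 < B₀' * B₁ * s := by positivity
  refine ⟨hex, fun lam h hfix => ?_, by linarith⟩
  have h' := hbd lam (by rw [e2]; exact h) hfix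
  exact h'.trans hq

/-- The repaired smallness condition in the G-B8-11/G-B8-12 reading `ρ = α₄ + α₄²` at the printed choice
`α₄ = 8B′₀B₁s`: `8B′₀C′₄(B₁s + ρ) = C′₄α₄(1 + 8B′₀(1 + α₄))`, i.e. the printed `C′₄α₄ ≤ 1` becomes
`C′₄α₄(1 + 8B′₀(1 + α₄)) ≤ 1` — a condition on `α₀ + α₁` alone with a smaller threshold `c₂` ("constants
only").  Ring identity on the printed constants. [cite: Balaban1985RegularSpaces, (1.103) p.93; α₄-choice p.94] -/
theorem repaired_condition_eq {B₀' B₁ C₄' s α₄ : ℝ} (hα₄ : α₄ = 8 * B₀' * B₁ * s) :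
    8 * B₀' * C₄' * (B₁ * s + (α₄ + α₄ ^ 2)) = C₄' * α₄ * (1 + 8 * B₀' * (1 + α₄)) := by
  rw [hα₄]
  ring

/-- A sufficient form of the repaired condition: `α₄ ≤ 1` and `C′₄α₄(1 + 16B′₀) ≤ 1` imply
`C′₄α₄(1 + 8B′₀(1 + α₄)) ≤ 1` (for `α₄ = 8B′₀B₁s` both are "α₀ + α₁ small").  Real arithmetic.
[cite: Balaban1985RegularSpaces, (1.103) p.93 (sufficient form of the repaired condition)] -/
theorem repaired_condition_of {B₀' C₄' α₄ : ℝ} (hB₀ : 0 ≤ B₀') (hC : 0 ≤ C₄') (hα₄ : 0 ≤ α₄) (h1 : α₄ ≤ 1)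
    (h2 : C₄' * α₄ * (1 + 16 * B₀') ≤ 1) :
    C₄' * α₄ * (1 + 8 * B₀' * (1 + α₄)) ≤ 1 := by
  have hCa : 0 ≤ C₄' * α₄ := mul_nonneg hC hα₄
  have h3 : 1 + 8 * B₀' * (1 + α₄) ≤ 1 + 16 * B₀' := by nlinarith
  calc C₄' * α₄ * (1 + 8 * B₀' * (1 + α₄)) ≤ C₄' * α₄ * (1 + 16 * B₀') :=
        mul_le_mul_of_nonneg_left h3 hCa
    _ ≤ 1 := h2

end Existence

/-! ## §2. "The uniqueness follows from the fact that the image of a set {λ : |λ|, |Dλ|₍₋₁₎ < ½α₄} by the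
transformation λ → λ − H′D′(u₁, λ) contains the set {λ′ : |λ′|, |Dλ′|₍₋₁₎ < ¼α₄}" (p. 94) — as pure logic over a
normed group. -/

section Uniqueness

variable {E : Type*} [NormedAddCommGroup E]

/-- **The printed uniqueness argument, abstractly.**  `frF` = the transformation 𝔉 of (1.100), `T` = the Sect. E
map `λ ↦ λ − H′D′(u₁, λ)` (1.113), `Sol μ` = "u′ = e^{iμ} satisfies (1.107)".  Hypotheses: the image bound of 𝔉 on
the open ½α-ball (radius `≤ ¼α`), uniqueness of fixed points in the closed ¼α-ball (the contraction), the "onto"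
sentence, and the dictionary "if `u′ = exp[i(λ − H′D′(u₁, λ))]` solves (1.107) and `|λ| < ½α₄` then `λ` solves
(1.100)" (Sect. C–D, (1.76)–(1.100)).  Conclusion: at most one `μ` with `‖μ‖ < ¼α` and `Sol μ` — (1.109) with
`c₃ = ¼α`. [cite: Balaban1985RegularSpaces, (1.109) p.94 and the sentence «The uniqueness follows from the fact
that the image … contains …» p.94] -/
theorem unique_of_onto (frF T : E → E) (Sol : E → Prop) {α : ℝ}
    (himg : ∀ lam : E, ‖lam‖ < α / 2 → ‖frF lam‖ ≤ α / 4)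
    (huniq : ∀ lam₁ lam₂ : E, ‖lam₁‖ ≤ α / 4 → ‖lam₂‖ ≤ α / 4 → frF lam₁ = lam₁ → frF lam₂ = lam₂ →
      lam₁ = lam₂)
    (honto : ∀ mu : E, ‖mu‖ < α / 4 → ∃ lam : E, ‖lam‖ < α / 2 ∧ T lam = mu)
    (hFixOfSol : ∀ lam : E, ‖lam‖ < α / 2 → Sol (T lam) → frF lam = lam) :
    ∀ mu₁ mu₂ : E, ‖mu₁‖ < α / 4 → ‖mu₂‖ < α / 4 → Sol mu₁ → Sol mu₂ → mu₁ = mu₂ := by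
  intro mu₁ mu₂ h₁ h₂ hs₁ hs₂
  obtain ⟨lam₁, hl₁, rfl⟩ := honto mu₁ h₁
  obtain ⟨lam₂, hl₂, rfl⟩ := honto mu₂ h₂
  have hf₁ := hFixOfSol lam₁ hl₁ hs₁
  have hf₂ := hFixOfSol lam₂ hl₂ hs₂
  have hn₁ : ‖lam₁‖ ≤ α / 4 := by
    have h := himg lam₁ hl₁
    rwa [hf₁] at h
  have hn₂ : ‖lam₂‖ ≤ α / 4 := by
    have h := himg lam₂ hl₂
    rwa [hf₂] at h
  rw [huniq lam₁ lam₂ hn₁ hn₂ hf₁ hf₂]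

/-- The same with a GIVEN fixed point `λ⋆` of the closed ¼α-ball: every `μ` with `‖μ‖ < ¼α` and `Sol μ` equals
`T λ⋆` — the form in which existence ((1.107)–(1.108), `μ⋆ = T λ⋆`) and uniqueness ((1.109)) speak of the same
configuration. [cite: Balaban1985RegularSpaces, (1.107)–(1.109) p.94] -/
theorem sol_eq_image_of_onto (frF T : E → E) (Sol : E → Prop) {α : ℝ}
    (himg : ∀ lam : E, ‖lam‖ < α / 2 → ‖frF lam‖ ≤ α / 4)
    (huniq : ∀ lam₁ lam₂ : E, ‖lam₁‖ ≤ α / 4 → ‖lam₂‖ ≤ α / 4 → frF lam₁ = lam₁ → frF lam₂ = lam₂ →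
      lam₁ = lam₂)
    (honto : ∀ mu : E, ‖mu‖ < α / 4 → ∃ lam : E, ‖lam‖ < α / 2 ∧ T lam = mu)
    (hFixOfSol : ∀ lam : E, ‖lam‖ < α / 2 → Sol (T lam) → frF lam = lam)
    {lamStar : E} (hstar : ‖lamStar‖ ≤ α / 4) (hfix : frF lamStar = lamStar) :
    ∀ mu : E, ‖mu‖ < α / 4 → Sol mu → mu = T lamStar := by
  intro mu hmu hsol
  obtain ⟨lam, hl, rfl⟩ := honto mu hmu
  have hf := hFixOfSol lam hl hsol
  have hn : ‖lam‖ ≤ α / 4 := by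
    have h := himg lam hl
    rwa [hf] at h
  rw [huniq lam lamStar hn hstar hf hfix]

/-- Uniqueness of fixed points in the closed ball from an `∃!` statement (the form in which
`B8SectDSource.fixedPoint_closedBall` delivers the contraction mapping theorem; elementary API for the
step «The contraction mapping theorem implies that there exists a unique fixed point» p.94).
[cite: Balaban1985RegularSpaces, p.94 (after (1.106))] -/
theorem eq_of_existsUnique_fixedPoint (frF : E → E) {r : ℝ}
    (hex : ∃! lam : E, ‖lam‖ ≤ r ∧ frF lam = lam) :
    ∀ lam₁ lam₂ : E, ‖lam₁‖ ≤ r → ‖lam₂‖ ≤ r → frF lam₁ = lam₁ → frF lam₂ = lam₂ → lam₁ = lam₂ := by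
  intro lam₁ lam₂ h₁ h₂ hf₁ hf₂
  obtain ⟨lam, -, hu⟩ := hex
  rw [hu lam₁ ⟨h₁, hf₁⟩, hu lam₂ ⟨h₂, hf₂⟩]

variable [NormedSpace ℝ E] [CompleteSpace E]

/-- The "onto" input in the shape used above, from `B8SectE.onto_of_lipschitz_half` (p. 97): if `F = H′D′(u₁, ·)`
is `½`-Lipschitz on the closed ½α-ball and `‖F λ‖ ≤ α/8` there (printed inputs (1.92), (1.121), (1.125) and
`α₃ + α₄` small, see `B8SectE.b8_sectE_smallness`), then every `μ` with `‖μ‖ < ¼α` is `λ − F λ` for some `λ` with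
`‖λ‖ < ½α`. [cite: Balaban1985RegularSpaces, p.97 (the «onto a set containing {λ′: |λ′| < ¼α₄, …}» sentence after
(1.125)); (1.113) p.95] -/
theorem onto_half_ball (Fmap : E → E) {α : ℝ} (hα : 0 ≤ α)
    (hlip : ∀ x ∈ closedBall (0 : E) (α / 2), ∀ y ∈ closedBall (0 : E) (α / 2),
      ‖Fmap x - Fmap y‖ ≤ (1 / 2) * ‖x - y‖)
    (hsmall : ∀ x ∈ closedBall (0 : E) (α / 2), ‖Fmap x‖ ≤ α / 8) :
    ∀ mu : E, ‖mu‖ < α / 4 → ∃ lam : E, ‖lam‖ < α / 2 ∧ lam - Fmap lam = mu := by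
  intro mu hmu
  obtain ⟨hex, hball⟩ := B8SectE.onto_of_lipschitz_half Fmap hα hlip hsmall mu hmu
  obtain ⟨lam, ⟨hmem, hlam⟩, -⟩ := hex
  exact ⟨lam, hball lam hmem, hlam⟩

end Uniqueness

/-! ## §3. Proposition 5 assembled: existence at the smallest `α₄ = 8B′₀B₁s`, uniqueness at the largest `α`. -/

section Assembly

variable {E F : Type*} [NormedAddCommGroup E] [NormedSpace ℂ E] [CompleteSpace E]
  [NormedAddCommGroup F] [NormedSpace ℂ F]

/-- **Proposition 5, both clauses, in the original variable `μ = λ − H′D′(u₁, λ)`.**  Inputs (all named, none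
asserted): `‖G′‖ ≤ B′₀`; `‖RD*A‖ ≤ B₁s`; the repaired (1.99) on the domain (1.102), `β = ½`, at the LARGEST
parameter `α` (p. 94: "largest possible α₄ … independent of α₀ + α₁") and at the SMALLEST `8B′₀B₁s ≤ α`, with
`Φ = R𝔉₄` analytic on the larger ball; the repaired smallness `8B′₀C′₄(B₁s + ρ) ≤ 1`; the Sect. E map `F = H′D′(u₁, ·)`
`½`-Lipschitz with `‖F‖ ≤ α/8` on the closed ½α-ball (p. 97) and with `‖F λ‖ ≤ φ` for `‖λ‖ ≤ 2B′₀B₁s` (Sect. E at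
the small parameter, remark (d) of the header); the dictionary in both directions (p. 94: "The solution λ of Eq.
(1.100) determines the configuration u′ = exp[i(λ − H′D′(u₁, λ))] we are looking for"; Sect. C–D for the
converse on `‖λ‖ < ½α`).  Conclusions: a fixed point `λ⋆` with `‖λ⋆‖ ≤ 2B′₀B₁s`; `μ⋆ := λ⋆ − Fλ⋆` solves (1.107)
with `‖μ⋆‖ ≤ 2B′₀B₁s + φ` ((1.108) in honest form); and every solution `μ` with `‖μ‖ < ¼α` equals `μ⋆` ((1.109),
`c₃ = ¼α`). [cite: Balaban1985RegularSpaces, Proposition 5 (1.107)–(1.109) p.94; inputs (1.99)–(1.103) p.93,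
p.97 (Sect. E onto sentence)] -/
theorem propFive_assembled (G' : F →L[ℂ] E) (g₀ : F) (Φ : E → F) (Fmap : E → E) (Sol : E → Prop)
    {B₀' B₁ C₄' s ρ α φ : ℝ}
    (hB₀ : 0 < B₀') (hB₁ : 0 < B₁) (hs : 0 < s) (hG : ‖G'‖ ≤ B₀') (hg₀ : ‖g₀‖ ≤ B₁ * s)
    (hαmin : 8 * B₀' * B₁ * s ≤ α)
    (hΦd : DifferentiableOn ℂ Φ (ball (0 : E) (α / 2)))
    (h99max : ∀ lam ∈ ball (0 : E) (α / 2), ‖Φ lam‖ ≤ C₄' * (B₁ * s + ρ) * α)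
    (h99min : ∀ lam ∈ ball (0 : E) (8 * B₀' * B₁ * s / 2),
      ‖Φ lam‖ ≤ C₄' * (B₁ * s + ρ) * (8 * B₀' * B₁ * s))
    (hsmall : 8 * B₀' * C₄' * (B₁ * s + ρ) ≤ 1)
    (hFlip : ∀ x ∈ closedBall (0 : E) (α / 2), ∀ y ∈ closedBall (0 : E) (α / 2),
      ‖Fmap x - Fmap y‖ ≤ (1 / 2) * ‖x - y‖)
    (hFsmall : ∀ x ∈ closedBall (0 : E) (α / 2), ‖Fmap x‖ ≤ α / 8)
    (hFmin : ∀ x : E, ‖x‖ ≤ 2 * B₀' * B₁ * s → ‖Fmap x‖ ≤ φ)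
    (hSolOfFix : ∀ lam : E, ‖lam‖ ≤ 2 * B₀' * B₁ * s → G' (g₀ + Φ lam) = lam → Sol (lam - Fmap lam))
    (hFixOfSol : ∀ lam : E, ‖lam‖ < α / 2 → Sol (lam - Fmap lam) → G' (g₀ + Φ lam) = lam) :
    ∃ lamStar : E, ‖lamStar‖ ≤ 2 * B₀' * B₁ * s ∧ G' (g₀ + Φ lamStar) = lamStar ∧
      Sol (lamStar - Fmap lamStar) ∧ ‖lamStar - Fmap lamStar‖ ≤ 2 * B₀' * B₁ * s + φ ∧
      ∀ mu : E, ‖mu‖ < α / 4 → Sol mu → mu = lamStar - Fmap lamStar := by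
  have hαpos : 0 < α := lt_of_lt_of_le (by positivity) hαmin
  -- existence at the smallest parameter
  have hΦd' : DifferentiableOn ℂ Φ (ball (0 : E) (8 * B₀' * B₁ * s / 2)) :=
    hΦd.mono (ball_subset_ball (by linarith))
  obtain ⟨hex, -, -⟩ := propFive_repaired_choice G' g₀ Φ hB₀ hB₁ hs hG hg₀ hΦd' h99min hsmall
  obtain ⟨lamStar, ⟨hnorm, hfix⟩, -⟩ := hex
  -- uniqueness at the largest parameter
  have hMα : 8 * B₀' * (C₄' * (B₁ * s + ρ) * α) ≤ α := by
    have e : 8 * B₀' * (C₄' * (B₁ * s + ρ) * α) = (8 * B₀' * C₄' * (B₁ * s + ρ)) * α := by ring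
    rw [e]
    exact mul_le_of_le_one_left hαpos.le hsmall
  have hm₀α : 8 * B₀' * (B₁ * s) ≤ α := by linarith
  obtain ⟨himgα, hqα, -, -, hexα, -⟩ :=
    fixedPoint_of_sup_bound G' g₀ Φ hαpos hG hg₀ hΦd h99max hMα hm₀α
  have himg : ∀ lam : E, ‖lam‖ < α / 2 → ‖G' (g₀ + Φ lam)‖ ≤ α / 4 := fun lam h =>
    (himgα lam (mem_ball_zero_iff.2 h)).trans hqα
  have huniq := eq_of_existsUnique_fixedPoint (fun lam => G' (g₀ + Φ lam)) hexα
  have honto := onto_half_ball Fmap hαpos.le hFlip hFsmall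
  have hstar : ‖lamStar‖ ≤ α / 4 := by linarith
  have hall := sol_eq_image_of_onto (fun lam => G' (g₀ + Φ lam)) (fun lam => lam - Fmap lam) Sol himg
    huniq honto hFixOfSol hstar hfix
  refine ⟨lamStar, hnorm, hfix, hSolOfFix lamStar hnorm hfix, ?_, hall⟩
  calc ‖lamStar - Fmap lamStar‖ ≤ ‖lamStar‖ + ‖Fmap lamStar‖ := norm_sub_le _ _
    _ ≤ 2 * B₀' * B₁ * s + φ := add_le_add hnorm (hFmin lamStar hnorm)

/-- **Proposition 5 in the printed shape.**  If moreover `φ ≤ 2B′₀B₁s` (the Sect. E bound `B′₀C′₂(α₃+α₄)α₄ ≤ ¼α₄`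
at `α₄ = 8B′₀B₁s`, printed condition `α₃ + α₄ ≦ 1/(4B′₀C′₂)` of p. 97) and `32B′₀B₁s ≤ α` (so that `8B′₀B₁s ≤ ¼α = c₃`;
one more clause of "α₀ + α₁ ≦ c₂"), then: there is a solution `μ` of (1.107) with the bound (1.108)
`‖μ‖ < 8B′₀B₁s` (indeed `≤ 4B′₀B₁s`), there is EXACTLY ONE solution with `‖μ‖ < ¼α` ((1.109), `c₃ = ¼α` independent
of `s`), and `8B′₀B₁s ≤ ¼α`. [cite: Balaban1985RegularSpaces, Proposition 5 (1.107)–(1.109) p.94] -/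
theorem propFive_printed_shape (G' : F →L[ℂ] E) (g₀ : F) (Φ : E → F) (Fmap : E → E) (Sol : E → Prop)
    {B₀' B₁ C₄' s ρ α φ : ℝ}
    (hB₀ : 0 < B₀') (hB₁ : 0 < B₁) (hs : 0 < s) (hG : ‖G'‖ ≤ B₀') (hg₀ : ‖g₀‖ ≤ B₁ * s)
    (h32 : 32 * B₀' * B₁ * s ≤ α)
    (hΦd : DifferentiableOn ℂ Φ (ball (0 : E) (α / 2)))
    (h99max : ∀ lam ∈ ball (0 : E) (α / 2), ‖Φ lam‖ ≤ C₄' * (B₁ * s + ρ) * α)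
    (h99min : ∀ lam ∈ ball (0 : E) (8 * B₀' * B₁ * s / 2),
      ‖Φ lam‖ ≤ C₄' * (B₁ * s + ρ) * (8 * B₀' * B₁ * s))
    (hsmall : 8 * B₀' * C₄' * (B₁ * s + ρ) ≤ 1)
    (hFlip : ∀ x ∈ closedBall (0 : E) (α / 2), ∀ y ∈ closedBall (0 : E) (α / 2),
      ‖Fmap x - Fmap y‖ ≤ (1 / 2) * ‖x - y‖)
    (hFsmall : ∀ x ∈ closedBall (0 : E) (α / 2), ‖Fmap x‖ ≤ α / 8)
    (hFmin : ∀ x : E, ‖x‖ ≤ 2 * B₀' * B₁ * s → ‖Fmap x‖ ≤ φ) (hφ : φ ≤ 2 * B₀' * B₁ * s)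
    (hSolOfFix : ∀ lam : E, ‖lam‖ ≤ 2 * B₀' * B₁ * s → G' (g₀ + Φ lam) = lam → Sol (lam - Fmap lam))
    (hFixOfSol : ∀ lam : E, ‖lam‖ < α / 2 → Sol (lam - Fmap lam) → G' (g₀ + Φ lam) = lam) :
    (∃ mu : E, Sol mu ∧ ‖mu‖ ≤ 4 * B₀' * B₁ * s ∧ ‖mu‖ < 8 * B₀' * B₁ * s) ∧
    (∃! mu : E, ‖mu‖ < α / 4 ∧ Sol mu) ∧
    8 * B₀' * B₁ * s ≤ α / 4 := by
  have hp : 0 < B₀' * B₁ * s := by positivity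
  have hαmin : 8 * B₀' * B₁ * s ≤ α := by linarith
  obtain ⟨lamStar, hnorm, hfix, hsol, hbd, hall⟩ := propFive_assembled G' g₀ Φ Fmap Sol hB₀ hB₁ hs hG hg₀
    hαmin hΦd h99max h99min hsmall hFlip hFsmall hFmin hSolOfFix hFixOfSol
  have h4 : ‖lamStar - Fmap lamStar‖ ≤ 4 * B₀' * B₁ * s := by linarith
  have hc₃ : 8 * B₀' * B₁ * s ≤ α / 4 := by linarith
  refine ⟨⟨lamStar - Fmap lamStar, hsol, h4, by linarith⟩, ?_, hc₃⟩
  refine ⟨lamStar - Fmap lamStar, ⟨by linarith, hsol⟩, fun mu hmu => hall mu hmu.1 hmu.2⟩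

/-- The arithmetic of remark (d): the printed Sect. E contraction condition `α₃ + α₄ ≦ 1/(4B′₀C′₂)` (p. 97) gives
`B′₀ · C′₂(α₃+α₄)α₄ ≤ ¼α₄`, i.e. `φ ≤ 2B′₀B₁s` at `α₄ = 8B′₀B₁s` (hypothesis `hφ` of `propFive_printed_shape`).
Real arithmetic. [cite: Balaban1985RegularSpaces, p.97 (condition «α₃ + α₄ ≤ 1/(4B′₀C′₂)»); p.94 (α₄-choice)] -/
theorem sectE_bound_quarter {B₀' C₂' α₃ α₄ : ℝ} (hB₀ : 0 < B₀') (hC : 0 < C₂') (hα₄ : 0 ≤ α₄)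
    (h : α₃ + α₄ ≤ 1 / (4 * B₀' * C₂')) :
    B₀' * (C₂' * (α₃ + α₄) * α₄) ≤ α₄ / 4 := by
  have hprod : B₀' * C₂' * (α₃ + α₄) ≤ 1 / 4 := by
    have h1 := mul_le_mul_of_nonneg_left h (le_of_lt (by positivity : 0 < B₀' * C₂'))
    calc B₀' * C₂' * (α₃ + α₄) ≤ B₀' * C₂' * (1 / (4 * B₀' * C₂')) := h1
      _ = 1 / 4 := by field_simp
  have e : B₀' * (C₂' * (α₃ + α₄) * α₄) = (B₀' * C₂' * (α₃ + α₄)) * α₄ := by ring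
  rw [e]
  nlinarith

end Assembly

/-! ## §4. Theorem 8 (Sect. H): "exactly one" for the source transformation, by the same logic. -/

section Source

variable {E F : Type*} [NormedAddCommGroup E] [NormedSpace ℂ E] [CompleteSpace E]
  [NormedAddCommGroup F] [NormedSpace ℂ F]

/-- **Uniqueness for the Sect. D contraction WITH A SOURCE TERM** (Theorem 8, p. 101: "there exists exactly one
gauge transformation u …"; the Sect. D part).  Data and smallness exactly as in `B8SectDSource.propFive_source`
(source `N` analytic with `‖N‖ ≤ ν`, `‖N − f‖ ≤ ν₁` on the ½α₄-ball; `C′₄α₄ ≤ ½`, `2B′₀B₁s + B′₀ν ≤ ¼α₄`,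
`16B′₀ν₁ ≤ α₄`), plus the Sect. E map `F` and the dictionary for the source problem (`Sol μ` = "u′ = e^{iμ}
satisfies (1.107) with the gauge condition (1.146)").  Conclusion: the fixed point `λ⋆` of
`𝔉_f = G′(N · + g₀ + Φ ·)` in `‖λ‖ ≤ ¼α₄` exists, and every solution `μ` with `‖μ‖ < ¼α₄` equals `λ⋆ − Fλ⋆`.
[cite: Balaban1985RegularSpaces, Theorem 8 p.101 («exactly one», by inspection of Sect. D); (1.146) p.101;
(1.109) p.94] -/
theorem source_uniqueness (G' : F →L[ℂ] E) (g₀ f : F) (Φ N : E → F) (Fmap : E → E) (Sol : E → Prop)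
    {B₀' B₁ C₄' s α₄ ν ν₁ : ℝ}
    (hα₄ : 0 < α₄) (hB₁ : 0 ≤ B₁) (hs : 0 ≤ s) (hC : 0 ≤ C₄') (hν₁ : 0 ≤ ν₁)
    (hG : ‖G'‖ ≤ B₀') (hg₀ : ‖g₀‖ ≤ B₁ * s)
    (hΦd : DifferentiableOn ℂ Φ (ball (0 : E) (α₄ / 2)))
    (h99 : ∀ lam ∈ ball (0 : E) (α₄ / 2), ‖Φ lam‖ ≤ C₄' * B₁ * s * α₄)
    (hNd : DifferentiableOn ℂ N (ball (0 : E) (α₄ / 2)))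
    (hN : ∀ lam ∈ ball (0 : E) (α₄ / 2), ‖N lam‖ ≤ ν)
    (hN₁ : ∀ lam ∈ ball (0 : E) (α₄ / 2), ‖N lam - f‖ ≤ ν₁)
    (h103a : C₄' * α₄ ≤ 1 / 2) (h103b : 2 * B₀' * B₁ * s + B₀' * ν ≤ (1 / 4) * α₄)
    (h103c : 16 * B₀' * ν₁ ≤ α₄)
    (hFlip : ∀ x ∈ closedBall (0 : E) (α₄ / 2), ∀ y ∈ closedBall (0 : E) (α₄ / 2),
      ‖Fmap x - Fmap y‖ ≤ (1 / 2) * ‖x - y‖)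
    (hFsmall : ∀ x ∈ closedBall (0 : E) (α₄ / 2), ‖Fmap x‖ ≤ α₄ / 8)
    (hFixOfSol : ∀ lam : E, ‖lam‖ < α₄ / 2 → Sol (lam - Fmap lam) → G' (N lam + g₀ + Φ lam) = lam) :
    ∃ lamStar : E, ‖lamStar‖ ≤ α₄ / 4 ∧ G' (N lamStar + g₀ + Φ lamStar) = lamStar ∧
      ‖lamStar‖ ≤ B₀' * ν + 2 * B₀' * B₁ * s ∧
      ∀ mu : E, ‖mu‖ < α₄ / 4 → Sol mu → mu = lamStar - Fmap lamStar := by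
  have hB : 0 ≤ B₀' := (norm_nonneg _).trans hG
  obtain ⟨h101, -, -, hex, hbd⟩ := B8SectDSource.propFive_source G' g₀ f Φ N hα₄ hB₁ hs hC hν₁ hG hg₀ hΦd h99
    hNd hN hN₁ h103a h103b h103c
  -- (1.101)_f sends the open ½α₄-ball into the closed ¼α₄-ball
  have himg : ∀ lam : E, ‖lam‖ < α₄ / 2 → ‖G' (N lam + g₀ + Φ lam)‖ ≤ α₄ / 4 := by
    intro lam h
    have h1 := h101 lam (mem_ball_zero_iff.2 h)
    have h2 : B₀' * C₄' * B₁ * s * α₄ ≤ B₀' * B₁ * s := by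
      have e : B₀' * C₄' * B₁ * s * α₄ = (B₀' * B₁ * s) * (C₄' * α₄) := by ring
      rw [e]
      have hp : 0 ≤ B₀' * B₁ * s := by positivity
      nlinarith
    linarith
  have huniq := eq_of_existsUnique_fixedPoint (fun lam => G' (N lam + g₀ + Φ lam)) hex
  obtain ⟨lamStar, ⟨hnorm, hfix⟩, -⟩ := hex
  have honto := onto_half_ball Fmap hα₄.le hFlip hFsmall
  have hall := sol_eq_image_of_onto (fun lam => G' (N lam + g₀ + Φ lam)) (fun lam => lam - Fmap lam) Sol
    himg huniq honto hFixOfSol hnorm hfix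
  exact ⟨lamStar, hnorm, hfix, hbd lamStar hnorm hfix, hall⟩

end Source

end Literature.MathematicalPhysics.QuantumFieldTheory.Balaban1983to89.B8Prop5Repaired
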